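import Mathlib
import Literature.MathematicalPhysics.QuantumFieldTheory.Balaban1983to89.T3AveragedTailProfile
import Literature.MathematicalPhysics.QuantumFieldTheory.Balaban1983to89.T3Thresholds
import Literature.MathematicalPhysics.QuantumFieldTheory.Balaban1983to89.T4PairDerivBridge
import Summits.QuantumFields.YangMills.Theorems.SmallFieldWideningLargeFieldMassRefinementTailOfHeightTail

/-!
# Route `SmallFieldWidening` — crux r3 `LargeFieldMassRefinementTail` (stmt-QuantumFields-22884), line `birth`: THE SUB-GAUSSIAN RUNG — the crux
# BY NAME from a cut-off-uniform SUB-GAUSSIAN MOMENT BOUND for the normalised block-averaged plaquette deviations `|Ū^{j}(∂p) − 1|/g_{K−j}` under the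
# interacting Gibbs laws (support file, instrument row; a concentration-language SUFFICIENT condition for `stub_avgTailPkg` — stronger than its
# per-plaquette schema `C·β^A·e^{−cp²}`, which keeps a polynomial slack `β^A`; the stub and the crux stay open)

Width seat `ym-line-sfw-p2-w2` (gen 4), 2026-08-28.  The route's kill criterion (i) / BC5 rung (ii) were settled at the GAUSSIAN level by gen 3
(`…GaussianRung`, `…GaussianRungMass`: in the linearised lattice-Maxwell model the height-`s` averaged plaquette has variance `≤ g_{K−s}²`, hence a
sub-Gaussian tail `e^{−p²/2}` per plaquette — the `AvgTailPkg` shape).  THIS FILE states the corresponding interface for the TRUE objects of the crux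
(Bałaban's non-linear (0.4) averaging `blockAvg ℰp` iterated `j` times, the `SU(2)` Wilson–Gibbs law `gibbsK F ℰp γ K`) in the standard language of
concentration of measure, and proves that it closes the crux BY NAME:

* §1 `measureReal_ge_le_of_mgf_le` — Chernoff: a real observable `X` with `∫ e^{tX} ≤ M·e^{σ²t²/2}` for all `t ≥ 0` (and `e^{tX}` integrable) has
  `μ{ε ≤ X} ≤ M·e^{−ε²/(2σ²)}` (`ε ≥ 0`; Mathlib's `ProbabilityTheory.measure_ge_le_exp_mul_mgf` at `t = ε/σ²`);
* §2 `integrable_exp_mul_dist1_iter` — for the bounded measurable observables `U ↦ |Ū^{j}(∂p) − 1|/g` the integrability side condition is free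
  (`dist1 ≤ 2` on `SU(2)`, measurable averaging maps `T3Family.avgMeasurable_of_measurableE`);
* §3 **`perPlaquette_of_subGaussianMGF`** — a `K`-, height- and plaquette-uniform sub-Gaussian moment bound
  `∫ exp(t·|Ū^{j}(∂p) − 1|/g_{K−j}) dGibbs_K ≤ M·e^{σ²t²/2}` (`t ≥ 0`, `1 ≤ j ≤ K`, all `p`) gives the per-plaquette schema of crux K2 / line birth v3
  (`Gibbs_K{θ(K−j) ≤ |Ū^{j}(∂p) − 1|} ≤ M·β_{K−j}^0·e^{−p(g_{K−j})²/(2σ²)}`, since `θ(i) = g_i p(g_i)`), hence **`averagedTailAt_of_subGaussianMGF`**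
  (`AveragedTailAt F γ b₀ p₀` for `0 < γ ≤ 1`, `0 < b₀`, `1 ≤ p₀`, by the tree's `T3AveragedTailProfile.averagedTailAt_of_perPlaquette`) and
  **`largeFieldMassRefinementTail_of_subGaussianMGF`** — r3 BY NAME under the route prefix (`∀ L ∃ b₀ p₀ γ₁ …`, one `(σ, M)` per family and coupling
  suffices: NO uniformity in `F`, `γ` or the volume is asked), via the landed bridge `largeFieldMassRefinementTail_of_averagedTail` (w2, p579220).

HONEST SCOPE.  The sub-Gaussian moment bound is the HYPOTHESIS (the probabilistic content of Bałaban's (α) representation at the averaged heights,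
[Balaban1985UV3] (41)/(71), phrased as a moment bound; no cut-off-uniform concentration inequality for weakly coupled non-abelian lattice gauge fields
is in print — the strong-coupling log-Sobolev results do not reach `β → ∞`).  CAVEAT (docfix v2): this interface is STRONGER than what the crux needs —
the per-plaquette schema of crux K2's line (`C·β_{K−j}^A·e^{−c·p(g_{K−j})²}`, tree `T3AveragedTailProfile.averagedTailAt_of_perPlaquette`) tolerates a
polynomial prefactor `β^A`, whereas a `K`-uniform `(σ, M)` does not; already at the BARE height the tree's reflection-positivity/chessboard tail
(`T3FinestHeightTail.gibbsK_real_not_plaqSmall_le`, prefactor `(√β_K)^9`) yields the schema but NOT a `K`-uniform moment bound (the crossover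
`s₀ ≈ √(9 log β_K)` grows with `K`), although the bound is physically expected (a plaquette variable is ≈ Gaussian at scale `g`).  Conditional; credits
nothing; the stub `stub_avgTailPkg`, the crux r3 and route `SmallFieldWidening` stay open.  No summit is proved (rung R3 record; the YM mass gap is NOT
touched).

References: T. Bałaban, CMP **102** (1985) 255–275 [Balaban1985UV3] ((7) p.257, (41) p.266, (71) p.273).
-/

noncomputable section

namespace Summit.QuantumFields.YangMills.Theorems.LargeFieldMassRefinementTailSubGaussianRung

open MeasureTheory ProbabilityTheory Real
open Literature.MathematicalPhysics.QuantumFieldTheory.Balaban1983to89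
open Literature.MathematicalPhysics.QuantumFieldTheory.Balaban1983to89.T4Continuum
open Literature.MathematicalPhysics.QuantumFieldTheory.Balaban1983to89.T3ContinuumYM3Torus
open Literature.MathematicalPhysics.QuantumFieldTheory.Balaban1983to89.T3UnitScaleTilt
open Literature.MathematicalPhysics.QuantumFieldTheory.Balaban1983to89.T3UnitLawDensityEML
open Literature.MathematicalPhysics.QuantumFieldTheory.Balaban1983to89.T3CruxEstimates
open Literature.MathematicalPhysics.QuantumFieldTheory.Balaban1983to89.T3BareTailProfile
open Literature.MathematicalPhysics.QuantumFieldTheory.Balaban1983to89.T3AveragedTailProfile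
open Literature.MathematicalPhysics.QuantumFieldTheory.Balaban1983to89.T3Thresholds
open Literature.MathematicalPhysics.QuantumFieldTheory.Balaban1983to89.T3ThresholdSmallness (sqrt_coupling_pos_le)
open Literature.MathematicalPhysics.QuantumFieldTheory.Balaban1983to89.T4PairDerivBridge (dist1_le_two_specialUnitaryGroup)

/-! ## §1 Chernoff: a sub-Gaussian moment-generating function gives a Gaussian tail -/

section Chernoff

variable {Ω : Type*} [MeasurableSpace Ω] {μ : Measure Ω} [IsProbabilityMeasure μ]

/-- **CHERNOFF**: if `∫ e^{tX} dμ ≤ M·e^{σ²t²/2}` for all `t ≥ 0` (with `e^{tX}` integrable), then `μ{ε ≤ X} ≤ M·e^{−ε²/(2σ²)}` for every `ε ≥ 0`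
(`ProbabilityTheory.measure_ge_le_exp_mul_mgf` at the optimal `t = ε/σ²`). [folklore] -/
theorem measureReal_ge_le_of_mgf_le {X : Ω → ℝ} {σ M : ℝ} (hσ : 0 < σ)
    (hint : ∀ t : ℝ, 0 ≤ t → Integrable (fun ω => exp (t * X ω)) μ)
    (hmgf : ∀ t : ℝ, 0 ≤ t → mgf X μ t ≤ M * exp (σ ^ 2 * t ^ 2 / 2)) {ε : ℝ} (hε : 0 ≤ ε) :
    μ.real {ω | ε ≤ X ω} ≤ M * exp (-(ε ^ 2 / (2 * σ ^ 2))) := by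
  have hσ2 : 0 < σ ^ 2 := by positivity
  set t : ℝ := ε / σ ^ 2 with ht
  have ht0 : 0 ≤ t := div_nonneg hε hσ2.le
  have h1 := measure_ge_le_exp_mul_mgf ε ht0 (hint t ht0)
  refine h1.trans ?_
  have hM := hmgf t ht0
  have hexp0 : 0 ≤ exp (-t * ε) := (exp_pos _).le
  calc exp (-t * ε) * mgf X μ t ≤ exp (-t * ε) * (M * exp (σ ^ 2 * t ^ 2 / 2)) :=
        mul_le_mul_of_nonneg_left hM hexp0
    _ = M * (exp (-t * ε) * exp (σ ^ 2 * t ^ 2 / 2)) := by ring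
    _ = M * exp (-(ε ^ 2 / (2 * σ ^ 2))) := by
        rw [← exp_add]
        congr 2
        rw [ht]
        field_simp
        ring

end Chernoff

/-! ## §2 The observables `|Ū^{j}(∂p) − 1|/g`: bounded and measurable, so the integrability side condition is free -/

section Observables

variable (F : T3Family)

/-- `U ↦ |Ū^{j}(∂p) − 1|` is measurable (measurable (0.4)-averaging maps for the measurable `ℰp`, measurable plaquette variable, measurable `dist1`).
[cite: Balaban1987RG1, (0.4) p.253] -/
theorem measurable_dist1_iter (K j : ℕ) (p : Plaq (F.P K) j) :
    Measurable fun U : GaugeField (F.P K) 0 (Matrix.specialUnitaryGroup (Fin 2) ℂ) =>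
      GaugeGroup.dist1 (GaugeField.plaqHol (Averaging.iter (fun i => BlockAveraging.blockAvg (P := F.P K) (j := i) ℰp) j U) p) :=
  RegularGaugeGroup.measurable_dist1.comp ((Missing.measurable_plaqHol p).comp
    (measurable_iter _ (F.avgMeasurable_of_measurableE ℰp measurableE_ℰp K) j))

/-- `0 ≤ |Ū^{j}(∂p) − 1| ≤ 2` on `SU(2)`. [folklore] -/
theorem dist1_iter_mem (K j : ℕ) (p : Plaq (F.P K) j) (U : GaugeField (F.P K) 0 (Matrix.specialUnitaryGroup (Fin 2) ℂ)) :
    0 ≤ GaugeGroup.dist1 (GaugeField.plaqHol (Averaging.iter (fun i => BlockAveraging.blockAvg (P := F.P K) (j := i) ℰp) j U) p) ∧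
      GaugeGroup.dist1 (GaugeField.plaqHol (Averaging.iter (fun i => BlockAveraging.blockAvg (P := F.P K) (j := i) ℰp) j U) p) ≤ 2 :=
  ⟨GaugeGroup.dist1_nonneg _, dist1_le_two_specialUnitaryGroup _⟩

/-- **INTEGRABILITY IS FREE**: for every finite measure `μ` on the fine fields, every `g > 0` and `t ≥ 0`, `U ↦ exp(t·|Ū^{j}(∂p) − 1|/g)` is integrable
(bounded by `e^{2t/g}`, measurable). [folklore] -/
theorem integrable_exp_mul_dist1_iter (K j : ℕ) (p : Plaq (F.P K) j) (μ : Measure (GaugeField (F.P K) 0 (Matrix.specialUnitaryGroup (Fin 2) ℂ)))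
    [IsFiniteMeasure μ] {g : ℝ} (hg : 0 < g) {t : ℝ} (ht : 0 ≤ t) :
    Integrable (fun U => exp (t * (GaugeGroup.dist1 (GaugeField.plaqHol
      (Averaging.iter (fun i => BlockAveraging.blockAvg (P := F.P K) (j := i) ℰp) j U) p) / g))) μ := by
  have hmeas : Measurable fun U : GaugeField (F.P K) 0 (Matrix.specialUnitaryGroup (Fin 2) ℂ) => exp (t * (GaugeGroup.dist1
      (GaugeField.plaqHol (Averaging.iter (fun i => BlockAveraging.blockAvg (P := F.P K) (j := i) ℰp) j U) p) / g)) :=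
    measurable_exp.comp (((measurable_dist1_iter F K j p).div_const g).const_mul t)
  refine (integrable_const (exp (t * (2 / g)))).mono' hmeas.aestronglyMeasurable (ae_of_all _ fun U => ?_)
  obtain ⟨h0, h2⟩ := dist1_iter_mem F K j p U
  rw [Real.norm_eq_abs, abs_of_pos (exp_pos _)]
  refine exp_le_exp.mpr (mul_le_mul_of_nonneg_left ?_ ht)
  exact div_le_div_of_nonneg_right h2 hg.le

end Observables

/-! ## §3 The per-plaquette schema, `AveragedTailAt`, and the crux BY NAME from the sub-Gaussian moment bound -/

section Rung

/-- **THE PER-PLAQUETTE SCHEMA FROM A SUB-GAUSSIAN MOMENT BOUND** (`γ > 0`, `b₀ ≥ 0`; one family, one coupling): if for some `σ > 0`, `M` the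
normalised deviations `|Ū^{j}(∂p) − 1|/g_{K−j}` have `∫ exp(t·|Ū^{j}(∂p) − 1|/g_{K−j}) dGibbs_K ≤ M·e^{σ²t²/2}` for all `t ≥ 0`, all cut-offs `K`, heights
`1 ≤ j ≤ K` and plaquettes `p`, then `Gibbs_K{θ(K−j) ≤ |Ū^{j}(∂p) − 1|} ≤ M·β_{K−j}^0·exp(−(1/(2σ²))·p(g_{K−j})²)` — the shape consumed by
`T3AveragedTailProfile.averagedTailAt_of_perPlaquette` (`C = M`, `A = 0`, `c = 1/(2σ²)`), since `θ(i) = g_i·p(g_i)` and `g_i > 0`.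
[cite: Balaban1985UV3, (7) p.257 and (71) p.273] -/
theorem perPlaquette_of_subGaussianMGF (F : T3Family) {γ b₀ p₀ : ℝ} (hγ : 0 < γ) (hγ1 : γ ≤ 1) (hb₀ : 0 ≤ b₀) {σ M : ℝ} (hσ : 0 < σ)
    (hmgf : ∀ (K j : ℕ), 1 ≤ j → j ≤ K → ∀ (p : Plaq (F.P K) j) (t : ℝ), 0 ≤ t →
      mgf (fun U => GaugeGroup.dist1 (GaugeField.plaqHol
          (Averaging.iter (fun i => BlockAveraging.blockAvg (P := F.P K) (j := i) ℰp) j U) p) /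
            Real.sqrt (γ * ((F.L : ℝ)⁻¹) ^ (K - j)))
        (gibbsK F ℰp γ K) t ≤ M * exp (σ ^ 2 * t ^ 2 / 2)) :
    ∀ (K j : ℕ), 1 ≤ j → j ≤ K → ∀ p : Plaq (F.P K) j,
      (gibbsK F ℰp γ K).real
          {U | θBal F.L γ b₀ p₀ (K - j) ≤
            GaugeGroup.dist1 (GaugeField.plaqHol
              (Averaging.iter (fun i => BlockAveraging.blockAvg (P := F.P K) (j := i) ℰp) j U) p)} ≤
        M * (F.scheme ℰp γ).β (K - j) ^ 0 *
          Real.exp (-(1 / (2 * σ ^ 2) * B10.pFun b₀ p₀ (Real.sqrt (γ * ((F.L : ℝ)⁻¹) ^ (K - j))) ^ 2)) := by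
  intro K j hj1 hjK p
  haveI := isProbabilityMeasure_gibbsK F ℰp hγ.le K
  have hL : 1 ≤ F.L := F.hL.2.le
  set g : ℝ := Real.sqrt (γ * ((F.L : ℝ)⁻¹) ^ (K - j)) with hg
  have hg0 : 0 < g := (sqrt_coupling_pos_le hL hγ (K - j)).1
  have hg1 : g ≤ 1 := coupling_le_one hL hγ hγ1 (K - j)
  set pg : ℝ := B10.pFun b₀ p₀ g with hpg
  have hpg0 : 0 ≤ pg := B10.pFun_nonneg b₀ p₀ g hb₀ hg0 hg1
  -- the event in normalised form: `θ ≤ dist1 ↔ p(g) ≤ dist1 / g`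
  have hset : {U : GaugeField (F.P K) 0 (Matrix.specialUnitaryGroup (Fin 2) ℂ) | θBal F.L γ b₀ p₀ (K - j) ≤
        GaugeGroup.dist1 (GaugeField.plaqHol
          (Averaging.iter (fun i => BlockAveraging.blockAvg (P := F.P K) (j := i) ℰp) j U) p)} =
      {U | pg ≤ GaugeGroup.dist1 (GaugeField.plaqHol
          (Averaging.iter (fun i => BlockAveraging.blockAvg (P := F.P K) (j := i) ℰp) j U) p) / g} := by
    ext U
    simp only [Set.mem_setOf_eq]
    rw [θBal_eq, ← hg, ← hpg, le_div_iff₀ hg0, mul_comm]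
  rw [hset]
  have htail := measureReal_ge_le_of_mgf_le (μ := gibbsK F ℰp γ K) hσ
    (fun t ht => integrable_exp_mul_dist1_iter F K j p (gibbsK F ℰp γ K) hg0 ht) (hmgf K j hj1 hjK p) hpg0
  refine htail.trans (le_of_eq ?_)
  rw [pow_zero, mul_one]
  congr 2
  ring

/-- **`AveragedTailAt` FROM A SUB-GAUSSIAN MOMENT BOUND** (`0 < γ ≤ 1`, `0 < b₀`, `1 ≤ p₀`): the per-plaquette schema of
`perPlaquette_of_subGaussianMGF` fed to the tree's bookkeeping `T3AveragedTailProfile.averagedTailAt_of_perPlaquette` (union bound over the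
`≤ 72L^{3(m+K−j)}` plaquettes of height `j`, Gaussian beats exponential). [cite: Balaban1985UV3, (71) p.273] -/
theorem averagedTailAt_of_subGaussianMGF (F : T3Family) {γ b₀ p₀ : ℝ} (hγ : 0 < γ) (hγ1 : γ ≤ 1) (hb₀ : 0 < b₀) (hp₀ : 1 ≤ p₀)
    (h : ∃ σ M : ℝ, 0 < σ ∧ 0 ≤ M ∧ ∀ (K j : ℕ), 1 ≤ j → j ≤ K → ∀ (p : Plaq (F.P K) j) (t : ℝ), 0 ≤ t →
      mgf (fun U => GaugeGroup.dist1 (GaugeField.plaqHol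
          (Averaging.iter (fun i => BlockAveraging.blockAvg (P := F.P K) (j := i) ℰp) j U) p) /
            Real.sqrt (γ * ((F.L : ℝ)⁻¹) ^ (K - j)))
        (gibbsK F ℰp γ K) t ≤ M * exp (σ ^ 2 * t ^ 2 / 2)) :
    AveragedTailAt F γ b₀ p₀ := by
  obtain ⟨σ, M, hσ, hM, hmgf⟩ := h
  exact averagedTailAt_of_perPlaquette F hγ hγ1 hb₀ hp₀
    ⟨M, 0, 1 / (2 * σ ^ 2), hM, by positivity, perPlaquette_of_subGaussianMGF F hγ hγ1 hb₀.le hσ hmgf⟩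

/-- **THE SUB-GAUSSIAN RUNG — r3 `LargeFieldMassRefinementTail` BY NAME**: if for every block size `L` there are a profile `(b₀, p₀)` (`0 < b₀`,
`2 < p₀`) and a threshold `0 < γ₁ ≤ 1` such that every family with `F.L = L` at every coupling `0 < γ ≤ γ₁` admits SOME `σ(F,γ) > 0`, `M(F,γ) ≥ 0`
with the cut-off-, height- and plaquette-uniform sub-Gaussian moment bound
`∫ exp(t·|Ū^{j}(∂p) − 1|/g_{K−j}) dGibbs_K ≤ M·e^{σ²t²/2}` (`t ≥ 0`, `1 ≤ j ≤ K`, all `p`), then the crux holds — `averagedTailAt_of_subGaussianMGF`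
composed with the landed level-shift bridge `LargeFieldMassRefinementTailOfHeightTail.largeFieldMassRefinementTail_of_averagedTail` (w2, p579220).
NO uniformity in the family, the coupling or the volume is needed.  CONDITIONAL: the moment bound is the (unprinted) probabilistic content of
Bałaban's (α) representation; nothing here discharges it. [cite: Balaban1985UV3, (41) p.266 and (71) p.273] -/
theorem largeFieldMassRefinementTail_of_subGaussianMGF
    (h : ∀ L : ℕ, ∃ b₀ p₀ γ₁ : ℝ, 0 < b₀ ∧ 2 < p₀ ∧ 0 < γ₁ ∧ γ₁ ≤ 1 ∧
      ∀ (F : T3Family) (γ : ℝ), F.L = L → 0 < γ → γ ≤ γ₁ →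
        ∃ σ M : ℝ, 0 < σ ∧ 0 ≤ M ∧ ∀ (K j : ℕ), 1 ≤ j → j ≤ K → ∀ (p : Plaq (F.P K) j) (t : ℝ), 0 ≤ t →
          mgf (fun U => GaugeGroup.dist1 (GaugeField.plaqHol
              (Averaging.iter (fun i => BlockAveraging.blockAvg (P := F.P K) (j := i) ℰp) j U) p) /
                Real.sqrt (γ * ((F.L : ℝ)⁻¹) ^ (K - j)))
            (gibbsK F ℰp γ K) t ≤ M * exp (σ ^ 2 * t ^ 2 / 2)) :
    Summit.QuantumFields.YangMills.Theses.SmallFieldWidening.LargeFieldMassRefinementTail :=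
  LargeFieldMassRefinementTailOfHeightTail.largeFieldMassRefinementTail_of_averagedTail fun L => by
    obtain ⟨b₀, p₀, γ₁, hb, hp, hγ₁, hγ₁1, h⟩ := h L
    exact ⟨b₀, p₀, γ₁, hb, hp, hγ₁, hγ₁1, fun F γ hFL hγ hle =>
      averagedTailAt_of_subGaussianMGF F hγ (hle.trans hγ₁1) hb (by linarith) (h F γ hFL hγ hle)⟩

end Rung

end Summit.QuantumFields.YangMills.Theorems.LargeFieldMassRefinementTailSubGaussianRung

end
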